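import Summits.AtomisticToContinuum.FouriersLaw.Theorems.VanishingNoiseTransferNoiseLocalityStubFlipDissipationBoundAux1
import Summits.AtomisticToContinuum.FouriersLaw.Theorems.VanishingNoiseTransferNoiseLocalityStubDuhamelFlipBoundAux1
import Summits.AtomisticToContinuum.FouriersLaw.Theorems.VanishingNoiseTransferNoiseLocalityStubDuhamelFlipBoundAux3
import Summits.AtomisticToContinuum.FouriersLaw.Theorems.OddSectorIrreversibilityBoundedResponse

/-!
# Stub `stub_flipDissipationBound` of crux `NoiseLocality` (line `relative-flip-energy-transfer`):
the flip dissipation of a noisy response density is bounded by the response coefficient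

File `--supports stmt-AtomisticToContinuum-11975` (crux `NoiseLocality`, route `VanishingNoiseTransfer`),
registered stub 3 of the skeleton `relative_flip_energy_transfer`.

**Theorem (`stub_flipDissipationBound`).** Pinned anharmonic chain `pinnedChain ω₂ lam β γ` (all parameters
`> 0`) between Langevin baths, `T > 0`, any length `N`, any flip rate `ε > 0`. Let `με` be the unique weak
steady family of `L + εS` (`S f = ∑_i (f∘Θ_i - f)` the velocity-flip generator), `Uε` ANY response density
of the family at `T` (`L²(μ_T)`, `HasDerivAt` clauses on test functions and on the total current) and
`Dε` the response coefficient. Then `ε (N-1) T² 𝓔_f(Uε) ≤ Dε`, `𝓔_f(U) = ½ ∑_i ∫ (U - U∘Θ_i)² dμ_T`.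

Proof (`N ≥ 2`; for `N ≤ 1` the total current vanishes identically, `Dε = 0`, and `(N-1) ≤ 0`). With
`μ_T` the Gibbs measure (`με T T = μ_T` by uniqueness), `J = ∑_i j_i`, `c = (N-1)T²`,
`φ = γ(p_0² - p_{N-1}²)/(2T²)`, `Θ(q,p) = (q,-p)`:
(1) `Dε = ∫ J Uε dμ_T` (`responseCoeff_eq`) and the weak adjoint equation
`∫ (LF + εSF) Uε dμ_T = -∫ F φ dμ_T` for `F ∈ C_c^∞` (`integral_flipGenerator_mul_responseDensity_gibbs`);
(2) with the flip-invariant McLennan potential `Ψ` (`LΨ = c⁻¹J + φ`, `SΨ = 0`, even in `p`) the pair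
`u = Ψ + Uε∘Θ`, `v = c⁻¹J - ε(SUε)∘Θ` is a WEAK SOLUTION PAIR of `L u = v`
(`∫ (Lg)(u∘Θ) = ∫ g (v∘Θ)` for test `g`: `weakPair_mclennanPotential` plus (1) plus the symmetry of `S`);
formally `u∘Θ = Ψ + Uε` is the solution `W̃/c` of `L_ε^† W̃ = -J` of the thesis docstring;
(3) the graph closure of `L|C_c^∞` in `L²(μ_T)` is dissipative (part 1,
`integral_mul_nonpos_of_weak_pair`): `∫ v u dμ_T ≤ 0`;
(4) expanding, `∫ JΨ = 0` (`J` odd, `Ψ` even, `μ_T` `Θ`-invariant), `∫ J (Uε∘Θ) = -∫ J Uε = -Dε`,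
`∫ (SUε∘Θ) Ψ = ∫ Uε (SΨ) = 0`, `∫ (SUε∘Θ)(Uε∘Θ) = ∫ Uε (SUε) = -𝓔_f(Uε)` (polarisation), so (3) reads
`-c⁻¹ Dε + ε 𝓔_f(Uε) ≤ 0`. (The bath dissipation `γT∑_b ‖∂_{p_b} F_n‖²` of the approximants is simply
dropped: `integral_generator_mul_self_nonpos`.) No definitions.
-/

noncomputable section

open MeasureTheory Filter Topology
open scoped ContDiff

namespace Summit.AtomisticToContinuum.FouriersLaw.Theorems.NoiseLocality

open Literature.MathematicalPhysics.KineticTheory.HeatConduction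
open Summit.AtomisticToContinuum.FouriersLaw.Theorems.OddSectorIrreversibility
open Summit.AtomisticToContinuum.FouriersLaw.Theorems.NoiseLocality.StubResponseDensityNoisy
open Summit.AtomisticToContinuum.FouriersLaw.Theorems.NoiseLocality.StubDuhamelFlipBound
open Literature.Barriers.AtomisticToContinuum.OpenChain

namespace StubFlipDissipationBound

variable {ω₂ lam β γ : ℝ} {N : ℕ} {T : ℝ}

/-- **The flip dissipation bound, main case `N ≥ 2`**, with the response density and its weak adjoint
equation already in hand: if `Uε ∈ L²(μ_T)` satisfies `∫ (L F + ε S F) Uε dμ_T = -∫ F φ dμ_T` for all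
test `F` (`φ` the McLennan source), then `ε (N-1) T² · ½∑_i ∫ (Uε - Uε∘Θ_i)² dμ_T ≤ ∫ J Uε dμ_T`
(any real `ε`: the sign of the rate is not used). See the module docstring. -/
theorem le_of_weak (hω : 0 < ω₂) (hl : 0 ≤ lam) (hβ : 0 < β) (hγ : 0 < γ) (hN : 2 ≤ N)
    (hT : 0 < T) (ε : ℝ) {Uε : PhaseSpace N → ℝ}
    (hUεm : MemLp Uε 2 ((pinnedChain ω₂ lam β γ).gibbsMeasure N T))
    (hEε : ∀ F : PhaseSpace N → ℝ, ContDiff ℝ ∞ F → HasCompactSupport F →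
      ∫ x, (pinnedChain ω₂ lam β γ).flipGenerator N T T ε F x * Uε x
          ∂((pinnedChain ω₂ lam β γ).gibbsMeasure N T) =
        -∫ x, F x * (γ / (2 * T ^ 2) * (x.2 ⟨0, by omega⟩ ^ 2 - x.2 ⟨N - 1, by omega⟩ ^ 2))
          ∂((pinnedChain ω₂ lam β γ).gibbsMeasure N T)) :
    ε * ((N : ℝ) - 1) * T ^ 2 *
        ((1 / 2) * ∑ i : Fin N, ∫ x, (Uε x - Uε (momentumFlip i x)) ^ 2
          ∂((pinnedChain ω₂ lam β γ).gibbsMeasure N T)) ≤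
      ∫ x, (∑ i : Fin N, (pinnedChain ω₂ lam β γ).bondCurrent N i x) * Uε x
        ∂((pinnedChain ω₂ lam β γ).gibbsMeasure N T) := by
  set P := pinnedChain ω₂ lam β γ with hP
  set π := P.gibbsMeasure N T with hπ_def
  haveI : IsProbabilityMeasure π := pinnedChain_isProbabilityMeasure_gibbsMeasure hω hl hβ.le γ N hT
  have hU1 := pinnedChain_contDiff_U ω₂ lam β γ (n := 1)
  have hV1 := pinnedChain_contDiff_V ω₂ lam β γ (n := 1)
  have hΘi : ∀ i : Fin N, MeasurePreserving (momentumFlip i) π π := fun i =>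
    P.measurePreserving_momentumFlip_gibbsMeasure N T i
  have hΘ : MeasurePreserving (momentumReversal N) π π :=
    OddResponseBound.DensityUnique.measurePreserving_momentumReversal_gibbsMeasure P N T
  -- the data
  set D : ℝ := ∫ x, (∑ i : Fin N, P.bondCurrent N i x) * Uε x ∂π with hD_def
  set E : ℝ := ∑ i : Fin N, ∫ x, (Uε x - Uε (momentumFlip i x)) ^ 2 ∂π with hE_def
  set c : ℝ := ((N : ℝ) - 1) * T ^ 2 with hc
  set Ψ : PhaseSpace N → ℝ := fun y => (((N : ℝ) - 1) * T ^ 2)⁻¹ * energyMoment P N y +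
    (-(2 * T ^ 2)⁻¹) * P.hamiltonian N y with hΨ
  set φ : PhaseSpace N → ℝ := fun x => γ / (2 * T ^ 2) * (x.2 ⟨0, by omega⟩ ^ 2 - x.2 ⟨N - 1, by omega⟩ ^ 2)
    with hφ
  set J : PhaseSpace N → ℝ := fun x => ∑ i : Fin N, P.bondCurrent N i x with hJ
  set SU : PhaseSpace N → ℝ := flipNoise N Uε with hSU
  have hc0 : 0 < c := by
    have h2 : (2 : ℝ) ≤ N := by exact_mod_cast hN
    have h1 : 0 < (N : ℝ) - 1 := by linarith
    positivity
  have hLΨ : ∀ x, P.generator N T T Ψ x = c⁻¹ * J x + φ x := fun x =>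
    pinnedChain_generator_mclennanPotential hN T hT.ne' x
  -- parities under `Θ`
  have hΨΘ : ∀ x : PhaseSpace N, Ψ (x.1, -x.2) = Ψ x := fun x => by
    simp only [hΨ, energyMoment_neg_momentum, OscillatorChain.hamiltonian_neg_momentum]
  have hJΘ : ∀ x : PhaseSpace N, J (x.1, -x.2) = -J x := fun x => by
    simp only [hJ, OscillatorChain.bondCurrent_neg_momentum, Finset.sum_neg_distrib]
  have hφΘ : ∀ x : PhaseSpace N, φ (x.1, -x.2) = φ x := fun x => by
    simp only [hφ, Pi.neg_apply, neg_sq]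
  -- `L²` memberships
  have hΨm : MemLp Ψ 2 π := memLp_mclennanPotential hω hl hβ hT N
  have hφm : MemLp φ 2 π := memLp_mclennanSource hω hl hβ hT _ _
  have hJm : MemLp J 2 π := memLp_totalCurrent hω hl hβ hT N
  have hSUm : MemLp SU 2 π := memLp_flipNoise hΘi hUεm
  have hUΘm : MemLp (fun x : PhaseSpace N => Uε (x.1, -x.2)) 2 π := hUεm.comp_measurePreserving hΘ
  have hSUΘm : MemLp (fun x : PhaseSpace N => SU (x.1, -x.2)) 2 π := hSUm.comp_measurePreserving hΘ
  have hUεΘi : ∀ i : Fin N, MemLp (fun x => Uε (momentumFlip i x)) 2 π := fun i =>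
    hUεm.comp_measurePreserving (hΘi i)
  -- (2) the weak pair `u = Ψ + Uε∘Θ`, `v = c⁻¹ J - ε (S Uε)∘Θ`
  set u : PhaseSpace N → ℝ := fun x => Ψ x + Uε (x.1, -x.2) with hu
  set v : PhaseSpace N → ℝ := fun x => c⁻¹ * J x - ε * SU (x.1, -x.2) with hv
  have hum : MemLp u 2 π := hΨm.add hUΘm
  have hvm : MemLp v 2 π := (hJm.const_mul c⁻¹).sub (hSUΘm.const_mul ε)
  have huv : ∀ g : PhaseSpace N → ℝ, ContDiff ℝ ∞ g → HasCompactSupport g →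
      ∫ x, P.generator N T T g x * u (x.1, -x.2) ∂π = ∫ x, g x * v (x.1, -x.2) ∂π := by
    intro g hg hgc
    have hgm : MemLp g 2 π := memLp_of_continuous_hasCompactSupport hg.continuous hgc π 2
    have hg2 : ContDiff ℝ 2 g := hg.of_le (by norm_cast)
    have hLgm : MemLp (P.generator N T T g) 2 π :=
      memLp_of_continuous_hasCompactSupport (P.continuous_generator hU1 hV1 N T T hg2)
        (P.hasCompactSupport_generator N T T hg2 hgc) π 2
    have eu : ∀ x : PhaseSpace N, u (x.1, -x.2) = Ψ x + Uε x := fun x => by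
      simp only [hu, neg_neg, Prod.mk.eta, hΨΘ]
    have ev : ∀ x : PhaseSpace N, v (x.1, -x.2) = -c⁻¹ * J x - ε * SU x := fun x => by
      simp only [hv, neg_neg, Prod.mk.eta, hJΘ]
      ring
    -- (2a) the McLennan weak pair `∫ (Lg) Ψ = ∫ g (-c⁻¹ J + φ)`
    have hWP : ∫ x, P.generator N T T g x * Ψ x ∂π = ∫ x, g x * (-c⁻¹ * J x + φ x) ∂π := by
      have h : ∫ x, P.generator N T T g x * Ψ (x.1, -x.2) ∂π =
          ∫ x, g x * P.generator N T T Ψ (x.1, -x.2) ∂π :=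
        weakPair_mclennanPotential ω₂ lam β γ N hT.ne' hg hgc
      have e2 : ∀ x : PhaseSpace N, P.generator N T T Ψ (x.1, -x.2) = -c⁻¹ * J x + φ x := fun x => by
        rw [hLΨ, hJΘ, hφΘ]
        ring
      calc ∫ x, P.generator N T T g x * Ψ x ∂π = ∫ x, P.generator N T T g x * Ψ (x.1, -x.2) ∂π :=
            integral_congr_ae (Eventually.of_forall fun x => by simp only [hΨΘ])
        _ = ∫ x, g x * P.generator N T T Ψ (x.1, -x.2) ∂π := h
        _ = ∫ x, g x * (-c⁻¹ * J x + φ x) ∂π :=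
            integral_congr_ae (Eventually.of_forall fun x => by simp only [e2])
    -- (2b) the weak adjoint equation `∫ (Lg) Uε = -∫ g φ - ε ∫ g (S Uε)`
    have hAE : ∫ x, P.generator N T T g x * Uε x ∂π =
        -(∫ x, g x * φ x ∂π) - ε * ∫ x, g x * SU x ∂π := by
      have h1 : ∫ x, P.flipGenerator N T T ε g x * Uε x ∂π = -∫ x, g x * φ x ∂π := hEε g hg hgc
      have iLU : Integrable (fun x => P.generator N T T g x * Uε x) π := hLgm.integrable_mul hUεm
      have iSg : Integrable (fun x => flipNoise N g x * Uε x) π :=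
        (memLp_flipNoise hΘi hgm).integrable_mul hUεm
      have hsplit : ∫ x, P.flipGenerator N T T ε g x * Uε x ∂π =
          (∫ x, P.generator N T T g x * Uε x ∂π) + ε * ∫ x, flipNoise N g x * Uε x ∂π := by
        rw [← integral_const_mul, ← integral_add iLU (iSg.const_mul ε)]
        exact integral_congr_ae (Eventually.of_forall fun x => by
          simp only [OscillatorChain.flipGenerator_eq_add_flipNoise]
          ring)
      have hsym : ∫ x, flipNoise N g x * Uε x ∂π = ∫ x, g x * SU x ∂π :=
        (integral_mul_flipNoise hΘi (hgm.integrable_mul hUεm) fun i => hgm.integrable_mul (hUεΘi i)).symm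
      rw [hsplit, hsym] at h1
      linarith
    have iLΨ : Integrable (fun x => P.generator N T T g x * Ψ x) π := hLgm.integrable_mul hΨm
    have iLU : Integrable (fun x => P.generator N T T g x * Uε x) π := hLgm.integrable_mul hUεm
    have igJ : Integrable (fun x => g x * J x) π := hgm.integrable_mul hJm
    have igφ : Integrable (fun x => g x * φ x) π := hgm.integrable_mul hφm
    have igS : Integrable (fun x => g x * SU x) π := hgm.integrable_mul hSUm
    calc ∫ x, P.generator N T T g x * u (x.1, -x.2) ∂π
        = ∫ x, (P.generator N T T g x * Ψ x + P.generator N T T g x * Uε x) ∂π :=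
          integral_congr_ae (Eventually.of_forall fun x => by simp only [eu]; ring)
      _ = (∫ x, P.generator N T T g x * Ψ x ∂π) + ∫ x, P.generator N T T g x * Uε x ∂π :=
          integral_add iLΨ iLU
      _ = (∫ x, g x * (-c⁻¹ * J x + φ x) ∂π) + (-(∫ x, g x * φ x ∂π) - ε * ∫ x, g x * SU x ∂π) := by
          rw [hWP, hAE]
      _ = -c⁻¹ * (∫ x, g x * J x ∂π) - ε * ∫ x, g x * SU x ∂π := by
          have e : ∫ x, g x * (-c⁻¹ * J x + φ x) ∂π =
              -c⁻¹ * (∫ x, g x * J x ∂π) + ∫ x, g x * φ x ∂π := by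
            rw [← integral_const_mul, ← integral_add (igJ.const_mul _) igφ]
            exact integral_congr_ae (Eventually.of_forall fun x => by ring)
          rw [e]
          ring
      _ = ∫ x, g x * v (x.1, -x.2) ∂π := by
          rw [← integral_const_mul, ← integral_const_mul, ← integral_sub (igJ.const_mul _) (igS.const_mul _)]
          exact integral_congr_ae (Eventually.of_forall fun x => by simp only [ev]; ring)
  -- (3) dissipativity of the graph closure
  have hdiss := StubFlipDissipationBound.integral_mul_nonpos_of_weak_pair hω hl hβ.le hγ hN hT hum hvm huv
  -- (4) expansion of `∫ v u`
  have h1 : ∫ x, J x * Ψ x ∂π = 0 := by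
    have h := integral_comp_reversal_gibbsMeasure P N T (fun x => J x * Ψ x)
    simp only [hJΘ, hΨΘ, neg_mul, integral_neg] at h
    rw [← hπ_def] at h
    linarith
  have h2 : ∫ x, J x * Uε (x.1, -x.2) ∂π = -D := by
    have h := integral_comp_reversal_gibbsMeasure P N T (fun x => J x * Uε (x.1, -x.2))
    simp only [hJΘ, neg_neg, Prod.mk.eta, neg_mul, integral_neg] at h
    rw [← hπ_def] at h
    have eD : ∫ x, J x * Uε x ∂π = D := rfl
    linarith
  have h3 : ∫ x, SU (x.1, -x.2) * Ψ x ∂π = 0 := by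
    have h := integral_comp_reversal_gibbsMeasure P N T (fun x => SU (x.1, -x.2) * Ψ x)
    simp only [neg_neg, Prod.mk.eta, hΨΘ] at h
    rw [← hπ_def] at h
    rw [← h]
    have hs := integral_mul_flipNoise hΘi (hΨm.integrable_mul hUεm) fun i => hΨm.integrable_mul (hUεΘi i)
    have hS0 : ∀ x, flipNoise N Ψ x = 0 := fun x => by
      rw [hΨ]
      exact flipNoise_mclennanPotential P _ _ x
    calc ∫ x, SU x * Ψ x ∂π = ∫ x, Ψ x * flipNoise N Uε x ∂π :=
          integral_congr_ae (Eventually.of_forall fun x => by simp only [hSU]; ring)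
      _ = ∫ x, flipNoise N Ψ x * Uε x ∂π := hs
      _ = 0 := by simp only [hS0, zero_mul, integral_zero]
  have h4 : ∫ x, SU (x.1, -x.2) * Uε (x.1, -x.2) ∂π = -(1 / 2) * E := by
    have h := integral_comp_reversal_gibbsMeasure P N T (fun x => SU (x.1, -x.2) * Uε (x.1, -x.2))
    simp only [neg_neg, Prod.mk.eta] at h
    rw [← hπ_def] at h
    rw [← h]
    have hpol := integral_mul_flipNoise_eq hΘi hUεm hUεm
    calc ∫ x, SU x * Uε x ∂π = ∫ x, Uε x * flipNoise N Uε x ∂π :=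
          integral_congr_ae (Eventually.of_forall fun x => by simp only [hSU]; ring)
      _ = -(1 / 2) * ∑ i : Fin N, ∫ x, (Uε (momentumFlip i x) - Uε x) * (Uε (momentumFlip i x) - Uε x) ∂π :=
          hpol
      _ = -(1 / 2) * E := by
          rw [hE_def]
          congr 1
          refine Finset.sum_congr rfl fun i _ => ?_
          exact integral_congr_ae (Eventually.of_forall fun x => by ring)
  have iJΨ : Integrable (fun x => J x * Ψ x) π := hJm.integrable_mul hΨm
  have iJU : Integrable (fun x => J x * Uε (x.1, -x.2)) π := hJm.integrable_mul hUΘm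
  have iSΨ : Integrable (fun x => SU (x.1, -x.2) * Ψ x) π := hSUΘm.integrable_mul hΨm
  have iSU : Integrable (fun x => SU (x.1, -x.2) * Uε (x.1, -x.2)) π := hSUΘm.integrable_mul hUΘm
  have hexp : ∫ x, v x * u x ∂π =
      (c⁻¹ * (∫ x, J x * Ψ x ∂π) + c⁻¹ * ∫ x, J x * Uε (x.1, -x.2) ∂π) -
        (ε * (∫ x, SU (x.1, -x.2) * Ψ x ∂π) + ε * ∫ x, SU (x.1, -x.2) * Uε (x.1, -x.2) ∂π) := by
    rw [← integral_const_mul, ← integral_const_mul, ← integral_const_mul, ← integral_const_mul,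
      ← integral_add (iJΨ.const_mul _) (iJU.const_mul _), ← integral_add (iSΨ.const_mul _) (iSU.const_mul _),
      ← integral_sub ((iJΨ.const_mul _).fun_add (iJU.const_mul _)) ((iSΨ.const_mul _).fun_add (iSU.const_mul _))]
    exact integral_congr_ae (Eventually.of_forall fun x => by simp only [hu, hv]; ring)
  rw [hexp, h1, h2, h3, h4] at hdiss
  -- (5) conclusion
  have key : ε * ((1 / 2) * E) ≤ c⁻¹ * D := by nlinarith [hdiss]
  calc ε * ((N : ℝ) - 1) * T ^ 2 * ((1 / 2) * E) = c * (ε * ((1 / 2) * E)) := by rw [hc]; ring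
    _ ≤ c * (c⁻¹ * D) := mul_le_mul_of_nonneg_left key hc0.le
    _ = D := by rw [← mul_assoc, mul_inv_cancel₀ hc0.ne', one_mul]

end StubFlipDissipationBound

/-- **Registered stub 3 `stub_flipDissipationBound` of crux `NoiseLocality` (line
`relative-flip-energy-transfer`).** For the pinned anharmonic chain (all parameters `> 0`), `T > 0`, any
`N`, any flip rate `ε > 0`, the unique weak steady family `με` of `L + εS`, ANY response density `Uε` of the
family at `T` (square-integrable for the Gibbs measure, representing the `δ`-derivatives at `0` of
`∫ g dμ_{T+δ/2,T-δ/2}` for test `g` and of the total current) and the response coefficient `Dε` (limit of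
`totalCurrent/δ` along `𝓝[≠] 0`): `ε (N-1) T² · ½∑_i ∫ (Uε - Uε∘Θ_i)² dμ_T ≤ Dε` (in particular `Dε ≥ 0`).
See the module docstring for the proof (weak adjoint equation, the flip-invariant McLennan potential as a
weak pair, dissipativity of the graph closure of the equilibrium generator on test functions, parity). -/
theorem stub_flipDissipationBound :
    ∀ ω₂ lam β γ : ℝ, 0 < ω₂ → 0 < lam → 0 < β → 0 < γ → ∀ T : ℝ, 0 < T → ∀ (N : ℕ) (ε : ℝ), 0 < ε →
    ∀ με : ℝ → ℝ → MeasureTheory.Measure (Literature.MathematicalPhysics.KineticTheory.HeatConduction.PhaseSpace N),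
    (∀ T_L T_R : ℝ, 0 < T_L → 0 < T_R →
      (Literature.MathematicalPhysics.KineticTheory.HeatConduction.pinnedChain ω₂ lam β γ).IsFlipSteadyState N T_L T_R ε
          (με T_L T_R) ∧
        ∀ ν : MeasureTheory.Measure (Literature.MathematicalPhysics.KineticTheory.HeatConduction.PhaseSpace N),
          (Literature.MathematicalPhysics.KineticTheory.HeatConduction.pinnedChain ω₂ lam β γ).IsFlipSteadyState
              N T_L T_R ε ν → ν = με T_L T_R) →
    ∀ Uε : Literature.MathematicalPhysics.KineticTheory.HeatConduction.PhaseSpace N → ℝ,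
    (MeasureTheory.MemLp Uε 2
          ((Literature.MathematicalPhysics.KineticTheory.HeatConduction.pinnedChain ω₂ lam β γ).gibbsMeasure N T) ∧
        (∀ g : Literature.MathematicalPhysics.KineticTheory.HeatConduction.PhaseSpace N → ℝ,
          ContDiff ℝ ((⊤ : ℕ∞) : WithTop ℕ∞) g → HasCompactSupport g →
            HasDerivAt (fun δ : ℝ => ∫ x, g x ∂(με (T + δ / 2) (T - δ / 2)))
              (∫ x, g x * Uε x
                ∂((Literature.MathematicalPhysics.KineticTheory.HeatConduction.pinnedChain ω₂ lam β γ).gibbsMeasure N T))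
              0) ∧
        HasDerivAt (fun δ : ℝ =>
            (Literature.MathematicalPhysics.KineticTheory.HeatConduction.pinnedChain ω₂ lam β γ).totalCurrent
              (με (T + δ / 2) (T - δ / 2)))
          (∑ i : Fin N, ∫ x,
            (Literature.MathematicalPhysics.KineticTheory.HeatConduction.pinnedChain ω₂ lam β γ).bondCurrent N i x * Uε x
              ∂((Literature.MathematicalPhysics.KineticTheory.HeatConduction.pinnedChain ω₂ lam β γ).gibbsMeasure N T))
          0) →
    ∀ Dε : ℝ,
    Filter.Tendsto (fun δ : ℝ =>
        (Literature.MathematicalPhysics.KineticTheory.HeatConduction.pinnedChain ω₂ lam β γ).totalCurrent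
          (με (T + δ / 2) (T - δ / 2)) / δ) (nhdsWithin 0 {(0 : ℝ)}ᶜ) (nhds Dε) →
    ε * ((N : ℝ) - 1) * T ^ 2 *
        ((1 / 2) * ∑ i : Fin N, ∫ x,
          (Uε x - Uε (Literature.MathematicalPhysics.KineticTheory.HeatConduction.momentumFlip i x)) ^ 2
            ∂((Literature.MathematicalPhysics.KineticTheory.HeatConduction.pinnedChain ω₂ lam β γ).gibbsMeasure N T)) ≤
      Dε := by
  intro ω₂ lam β γ hω hl hβ hγ T hT N ε _hε με hμε Uε hUε Dε hDε
  obtain ⟨hUεm, hUεg, hUεJ⟩ := hUε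
  -- the diagonal member is the Gibbs measure
  have hπε : με T T = (pinnedChain ω₂ lam β γ).gibbsMeasure N T :=
    flipSteadyFamily_eq_gibbsMeasure hω hl.le hβ.le γ hT ε με hμε
  -- the response coefficient as a pairing with the total current
  have hDε' := responseCoeff_eq με hπε hUεJ hDε
  rcases Nat.lt_or_ge N 2 with hN | hN
  · -- `N ≤ 1`: no current at all, and `N - 1 ≤ 0`
    have hN1 : N ≤ 1 := by omega
    have hε0 : Dε = 0 := responseCoeff_eq_zero_of_le_one (pinnedChain ω₂ lam β γ) hN1 με hDε
    rw [hε0]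
    interval_cases N
    · simp
    · simp
  -- `N ≥ 2`
  haveI : IsProbabilityMeasure ((pinnedChain ω₂ lam β γ).gibbsMeasure N T) :=
    pinnedChain_isProbabilityMeasure_gibbsMeasure hω hl.le hβ.le γ N hT
  -- the weak adjoint equation
  have hEε : ∀ F : PhaseSpace N → ℝ, ContDiff ℝ ∞ F → HasCompactSupport F →
      ∫ x, (pinnedChain ω₂ lam β γ).flipGenerator N T T ε F x * Uε x
          ∂((pinnedChain ω₂ lam β γ).gibbsMeasure N T) =
        -∫ x, F x * (γ / (2 * T ^ 2) * (x.2 ⟨0, by omega⟩ ^ 2 - x.2 ⟨N - 1, by omega⟩ ^ 2))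
          ∂((pinnedChain ω₂ lam β γ).gibbsMeasure N T) := fun F hF hFc =>
    integral_flipGenerator_mul_responseDensity_gibbs hω hl.le hβ.le hN hT ε με
      (fun T_L T_R hL hR => (hμε T_L T_R hL hR).1) hπε hUεg hF hFc
  -- `Dε = ∫ J Uε dμ_T`
  have hsum : ∑ i : Fin N, ∫ x, (pinnedChain ω₂ lam β γ).bondCurrent N i x * Uε x
        ∂((pinnedChain ω₂ lam β γ).gibbsMeasure N T) =
      ∫ x, (∑ i : Fin N, (pinnedChain ω₂ lam β γ).bondCurrent N i x) * Uε x
        ∂((pinnedChain ω₂ lam β γ).gibbsMeasure N T) := by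
    have hi : ∀ i : Fin N, Integrable (fun x => (pinnedChain ω₂ lam β γ).bondCurrent N i x * Uε x)
        ((pinnedChain ω₂ lam β γ).gibbsMeasure N T) := fun i =>
      (memLp_bondCurrent_gibbsMeasure hω hl.le hβ.le γ N hT i).integrable_mul hUεm
    rw [← integral_finsetSum _ fun i _ => hi i]
    exact integral_congr_ae (Eventually.of_forall fun x => by simp only [Finset.sum_mul])
  rw [hDε', hsum]
  exact StubFlipDissipationBound.le_of_weak hω hl.le hβ hγ hN hT ε hUεm hEε

end Summit.AtomisticToContinuum.FouriersLaw.Theorems.NoiseLocality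

end
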